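import Summits.CriticalPhenomena.Ising3DConformalLimit.Theses.PerfectScreening
import Summits.CriticalPhenomena.Ising3DConformalLimit.Theorems.PerfectScreeningSubharmonicOffOriginPskDefs
import Summits.CriticalPhenomena.Ising3DConformalLimit.Theorems.PerfectScreeningSubharmonicOffOriginStubMassiveGreenPoisson
import Summits.CriticalPhenomena.Ising3DConformalLimit.Theorems.PerfectScreeningSubharmonicOffOriginStubMassiveGreenNonneg
import Summits.CriticalPhenomena.Ising3DConformalLimit.Theorems.PerfectScreeningSubharmonicOffOriginStubMixtureSubharmonic
import HarnessLib

/-!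
# Skeleton — line `SketchIdeator1` (planar-source Källén–Lehmann mixture) for the crux
# `SubharmonicOffOrigin` (stmt-CriticalPhenomena-1341, route PerfectScreening)

Lead prover-line-stmt-CriticalPhenomena-1341-a1-0 (re-seat a1), reshaped from the round-1 ideator-1 sketch
`Cruxes/SubharmonicOffOrigin/SketchIdeator1.lean`.  Objects in
`Theorems/PerfectScreeningSubharmonicOffOriginPskDefs.lean` (`massiveGreen`, `planeSite`,
`PlanarSourceMixture`).

Composition (`of_parts` / `SubharmonicOffOrigin_of`, glue only): a planar-source mixture of massive lattice Green
functions is lattice-subharmonic off the source plane `{x 0 = 0}` — every summand satisfies the massive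
Poisson identity `(6 + s) G_s(z) − Σ_nbrs G_s = δ_{z,0}`, so off the plane `ΔG = Σ_y ∫ s·G_s dα_y ≥ 0`
(`G_s ≥ 0`, `s ≥ 0` a.e.) — and cubic symmetry of `criticalTwoPoint 3` moves the plane, so `ΔG(x) ≥ 0` at
every `x ≠ 0`.

Stubs (sorries live ONLY in `stub_*`; v3: stubs 1–3 LANDED and imported, the ONLY sorry is the transfer target):
* `stub_massiveGreen_poisson` (support, LANDED p120175): `(6 + s) G_s(x) − Σᵢ (G_s(x+eᵢ) + G_s(x−eᵢ)) = [x = 0]`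
  for `s ≥ 0` on `ℤ³` (Fourier symbol of the Laplacian + orthogonality, as `LatticeGreenPoisson.lean`).
* `stub_massiveGreen_nonneg`  (support, LANDED p120188): Poisson ⇒ `G_s ≥ 0` for `s ≥ 0` (minimum principle
  at infinity on `{G_s < 0}` + Riemann–Lebesgue decay, as `latticeGreen_nonneg`; `s = 0` is in the tree);
  stated CONDITIONALLY on the Poisson identity so that the two workers are independent — the composition
  feeds stub 2 into stub 1.
* `stub_mixture_subharmonic` (support, LANDED p120371): positivity + Poisson + `PlanarSourceMixture` ⇒ the crux
  (stencil through `∑'`/`∫`, then `twoPointPlus_perm_invariant_holds` for the on-plane sites).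
* `stub_planarSourceMixture` (CRUX-strength; held by the lead): the transfer target itself — analysed FALSE at small mass
  (physics-level, `Lines/SketchIdeator1.dead.md`, evidence `stub_planarSourceMixture_ANALYSIS.md`): the line is closed
  modulo a false stub, i.e. DEAD; this file records the kernel-checked reduction `PlanarSourceMixture → SubharmonicOffOrigin`.
-/

noncomputable section

open MeasureTheory
open Literature.Probability.LatticeModels
open Summit.CriticalPhenomena.Ising3DConformalLimit.Theses.PerfectScreening

namespace Summit.CriticalPhenomena.Ising3DConformalLimit.Theorems.PerfectScreening.Psk

/-! Stubs 1–3 are LANDED tree theorems (imported, same namespace, registered signatures):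
`stub_massiveGreen_nonneg` (p120188, `…StubMassiveGreenNonneg.lean`), `stub_massiveGreen_poisson` (p120175,
`…StubMassiveGreenPoisson.lean`), `stub_mixture_subharmonic` (p120371, `…StubMixtureSubharmonic.lean`). -/

/-- Stub 4 (CRUX-strength, the transfer target): the critical two-point function of `ℤ³` is a planar-source
mixture of massive lattice Green functions. -/
theorem stub_planarSourceMixture : PlanarSourceMixture := by
  sorry

/-- COMPOSITION, glue only: positivity-from-Poisson, Poisson, mixture lemma and the transfer target give
the crux. -/
theorem of_parts
    (h1 : (∀ s : ℝ, 0 ≤ s → ∀ x : Site 3,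
      (6 + s) * massiveGreen s x
          - ∑ i : Fin 3, (massiveGreen s (x + Pi.single i 1) + massiveGreen s (x - Pi.single i 1))
        = if x = 0 then 1 else 0) →
      ∀ s : ℝ, 0 ≤ s → ∀ x : Site 3, 0 ≤ massiveGreen s x)
    (h2 : ∀ s : ℝ, 0 ≤ s → ∀ x : Site 3,
      (6 + s) * massiveGreen s x
          - ∑ i : Fin 3, (massiveGreen s (x + Pi.single i 1) + massiveGreen s (x - Pi.single i 1))
        = if x = 0 then 1 else 0)
    (h3 : (∀ s : ℝ, 0 ≤ s → ∀ x : Site 3, 0 ≤ massiveGreen s x) →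
      (∀ s : ℝ, 0 ≤ s → ∀ x : Site 3,
        (6 + s) * massiveGreen s x
            - ∑ i : Fin 3, (massiveGreen s (x + Pi.single i 1) + massiveGreen s (x - Pi.single i 1))
          = if x = 0 then 1 else 0) →
      PlanarSourceMixture → SubharmonicOffOrigin)
    (h4 : PlanarSourceMixture) :
    SubharmonicOffOrigin :=
  h3 (h1 h2) h2 h4

/-- The crux BY NAME, modulo the four registered stubs (kernel-checked composition). -/
theorem SubharmonicOffOrigin_of : SubharmonicOffOrigin :=
  of_parts stub_massiveGreen_nonneg stub_massiveGreen_poisson stub_mixture_subharmonic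
    stub_planarSourceMixture

end Summit.CriticalPhenomena.Ising3DConformalLimit.Theorems.PerfectScreening.Psk

end
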